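import Summits.Ventures.PercRepro.RankLevelSetPerElemThreeGood

/-! # RankLevelSetPerElemThreeClass — (★★) AND MONO ON EVERY MATROID WITH AT MOST `9` ELEMENTS AND ON EVERY
MATROID OF RANK AT MOST `5` (night-1 g36; dossier §48.6; on `RankLevelSetPerElemThreeGood`)

With the per-element inequality (★★) a theorem at the levels `j ≤ 3` for every finite matroid (`perElemAt_one`,
`perElemAt_two`, `perElemAt_three`, and the trivial level `0`, `perElemAt_zero`), the full `Prop` `BiIndepPerElem M`
— (★★) at every level `j` with `2j + 1 < #E` — holds as soon as no level `j ≥ 4` is in range, i.e. on every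
matroid with `#E ≤ 9` (**`biIndepPerElem_of_ncard_le_nine`**), and as soon as the levels `j ≥ 4` are empty, i.e.
on every matroid of rank `≤ 5` (**`biIndepPerElem_of_eRank_le_five`**: a bi-independent `j`-set has an
independent complement of `#E − j ≥ j + 2 ≥ 6` elements). Summed over the elements these are Mono
(**`biIndepMono_of_ncard_le_nine`**, **`biIndepMono_of_eRank_le_five`** — extending g31's rank `≤ 3` class). Every
declaration has a docstring; imports: the cell's own modules and Mathlib only. Axioms: standard. -/

namespace PercRepro

open Set Matroid

variable {α : Type} (M : Matroid α) [M.Finite]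

/-! ## Level `0` -/

/-- **(★★) at level `0`**: at most one bi-independent `0`-set avoids `y` (namely `∅`, when `E` is independent), and
then `{y}` is a bi-independent `1`-set through `y`. -/
theorem perElemAt_zero {y : α} (hy : y ∈ M.E) :
    {Z ∈ biIndep M 0 | y ∉ Z}.ncard ≤ {Q ∈ biIndep M 1 | y ∈ Q}.ncard := by
  by_cases h0 : (∅ : Set α) ∈ biIndep M 0
  · have h1 : ({y} : Set α) ∈ {Q ∈ biIndep M 1 | y ∈ Q} :=
      ⟨singleton_mem_biIndep_of_empty_mem M h0 hy, Set.mem_singleton y⟩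
    have hR : 1 ≤ {Q ∈ biIndep M 1 | y ∈ Q}.ncard :=
      (Set.ncard_pos ((biIndep_finite M 1).subset (fun Q hQ => hQ.1))).mpr ⟨{y}, h1⟩
    have hL : {Z ∈ biIndep M 0 | y ∉ Z}.ncard ≤ 1 := by
      calc {Z ∈ biIndep M 0 | y ∉ Z}.ncard ≤ (biIndep M 0).ncard :=
            Set.ncard_le_ncard (fun Z hZ => hZ.1) (biIndep_finite M 0)
        _ ≤ 1 := biIndepCount_zero_le_one M
    omega
  · have hempty : {Z ∈ biIndep M 0 | y ∉ Z} = ∅ := by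
      rw [Set.eq_empty_iff_forall_notMem]
      rintro Z ⟨hZ, -⟩
      have hZe : Z = ∅ := (Set.ncard_eq_zero (M.ground_finite.subset hZ.1)).mp hZ.2.1
      exact h0 (hZe ▸ hZ)
    rw [hempty, Set.ncard_empty]
    exact Nat.zero_le _

/-- **(★★) at every level `j ≤ 3`** for every finite matroid and every element, whenever `2j + 1 < #E`. -/
theorem perElemAt_le_three {y : α} (hy : y ∈ M.E) {j : ℕ} (hj : j ≤ 3) (hn : 2 * j + 1 < M.E.ncard) :
    {Z ∈ biIndep M j | y ∉ Z}.ncard ≤ {Q ∈ biIndep M (j + 1) | y ∈ Q}.ncard := by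
  interval_cases j
  · exact perElemAt_zero M hy
  · exact perElemAt_one M hy (by omega)
  · exact perElemAt_two M hy (by omega)
  · exact perElemAt_three M hy (by omega)

/-! ## Matroids with at most `9` elements -/

/-- **(★★) holds on every matroid with at most `9` elements**: every level in range has `j ≤ 3`. -/
theorem biIndepPerElem_of_ncard_le_nine (hn : M.E.ncard ≤ 9) : BiIndepPerElem M :=
  fun _ hy j hj => perElemAt_le_three M hy (by omega) hj

/-- **Mono holds on every matroid with at most `9` elements**: `(#E − j)·D_j ≤ (j + 1)·D_{j+1}` for `2j + 1 < #E`. -/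
theorem biIndepMono_of_ncard_le_nine (hn : M.E.ncard ≤ 9) : BiIndepMono M :=
  biIndepMono_of_perElem M (biIndepPerElem_of_ncard_le_nine M hn)

/-! ## Matroids of rank at most `5` -/

/-- No bi-independent `j`-set exists when `#E − j` exceeds the rank: its complement would be an independent set
of `#E − j` elements. -/
lemma biIndep_eq_empty_of_eRank_lt {j : ℕ} (hr : M.eRank < ((M.E.ncard - j : ℕ) : ℕ∞)) :
    biIndep M j = ∅ := by
  rw [Set.eq_empty_iff_forall_notMem]
  rintro Z ⟨hZE, hZj, -, hcind⟩
  have hZfin : Z.Finite := M.ground_finite.subset hZE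
  have hcard : (M.E \ Z).ncard = M.E.ncard - j := by
    rw [Set.ncard_sdiff hZE hZfin, hZj]
  have h1 : ((M.E.ncard - j : ℕ) : ℕ∞) ≤ M.eRank := by
    rw [← hcard, (M.ground_finite.subset Set.sdiff_subset).cast_ncard_eq]
    exact hcind.encard_le_eRank
  exact absurd (lt_of_lt_of_le hr h1) (lt_irrefl _)

/-- **(★★) holds on every matroid of rank at most `5`**: the levels `j ≤ 3` are theorems, and at a level `j ≥ 4`
with `2j + 1 < #E` a bi-independent `j`-set would have an independent complement of `#E − j ≥ 6` elements. -/
theorem biIndepPerElem_of_eRank_le_five (hr : M.eRank ≤ 5) : BiIndepPerElem M := by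
  intro y hy j hj
  rcases Nat.lt_or_ge j 4 with h4 | h4
  · exact perElemAt_le_three M hy (by omega) hj
  · have hempty : biIndep M j = ∅ := by
      refine biIndep_eq_empty_of_eRank_lt M (lt_of_le_of_lt hr ?_)
      have h6 : (6 : ℕ) ≤ M.E.ncard - j := by omega
      calc (5 : ℕ∞) < ((6 : ℕ) : ℕ∞) := by norm_num
        _ ≤ ((M.E.ncard - j : ℕ) : ℕ∞) := by exact_mod_cast h6
    have hL : {Z ∈ biIndep M j | y ∉ Z} = ∅ := by
      rw [hempty]
      ext Z
      simp
    rw [hL, Set.ncard_empty]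
    exact Nat.zero_le _

/-- **Mono holds on every matroid of rank at most `5`** (g31 had rank `≤ 3`). -/
theorem biIndepMono_of_eRank_le_five (hr : M.eRank ≤ 5) : BiIndepMono M :=
  biIndepMono_of_perElem M (biIndepPerElem_of_eRank_le_five M hr)

end PercRepro
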